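import Summits.ABC.StewartYu.PadicG3SatNSizes
import Summits.ABC.StewartYu.PadicG3SchedInst
import HarnessLib

/-!
# Cell abc-stewartyu, WP-L.P(odd) (crux r3 `PadicCoreOddRat`, stmt-ABC-20503): END SIZING of the saturated frame on the record schedule `schedN b`
# (END letters `XfinOS`, `S0NV`, `D0N`, `DN` of p1's `PadicG3ParN`, matching `recordOddN_datum`)

`Summits/ABC/StewartYu/PadicG3SatNEnd.lean` — cell `abc-stewartyu` (seat p2-g6; pack twin, END sizing; record owner p1 g10).  Proofs only; no definition,
no named fact.  Twin of `PadicG3SchedInst.endSizingV` / `PadicG3SchedB.endSizingVb` for the VIRTUAL END box `2·Lb(svS) ŜN j ≤ DN j`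
(`svS = N·side`, `DN j = ⌊K·N·LV/(2^ŜN·Aⱼ)⌋ + 1`, `K ≥ 2`, box scale `b ≥ 1`):

* `two_mul_Lb_svS_Sd_le`: `2·Lb (svS F (schedN b)) ŜN j ≤ DN j`;
* `endSizingSatN`: the four END-sizing hypotheses of `recordSupplyAtSatR_of_pack` at `Sc = schedN b` with
  `(X', S₀, D₀, D) = (XfinOS (schedN b), S0NV, D0N, DN)` — `XfinOS (schedN b) = 2ⁿ·XsV ŜN / (2(n+1))` by `rfl`.

References: Yu. V. Nesterenko, LNM 1819 (2003) §5 (5.4)–(5.8).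
-/

noncomputable section

open Finset Real

namespace Summit.ABC.StewartYu

namespace G3Setup

variable {p : ℕ} [Fact p.Prime] (S : G3Setup p) (F : S.SatData) (P : PadicG3ParN S.n) (b : ℝ)

/-- `XfinOS (schedN b) = 2ⁿ·XsV ŜN / (2(n+1))` (the END range of `recordOddN_datum`). [folklore] -/
theorem XfinOS_N_eq : S.XfinOS (P.schedN b) = 2 ^ S.n * P.XsV P.SdN / (2 * (S.n + 1)) := rfl

/-- **The virtual END box**: `2·Lb (svS) ŜN j ≤ DN j` for `K ≥ 2`, `b ≥ 1`, the record's `N` being the frame's. [cite: Nesterenko2003, §5.2 (5.5); shape only] -/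
theorem two_mul_Lb_svS_Sd_le (hPN : P.N = F.N) (hK : 2 ≤ P.K) (hb : 1 ≤ b) (j : Fin S.n) :
    2 * S.Lb (S.svS F (P.schedN b)) P.SdN j ≤ P.DN j := by
  have hN : (0 : ℝ) < F.N := by exact_mod_cast F.hN
  have hA := P.A_pos j
  have hK' : (2 : ℝ) ≤ P.K := by exact_mod_cast hK
  have hL : (0 : ℝ) ≤ P.LV := by positivity
  have h1 := S.Lb_le_real (S.svS F (P.schedN b)) P.SdN j
  have h2 := S.sideS₂_N_le P b hb j
  have hsv : (S.svS F (P.schedN b) j : ℝ) = F.N * S.sideS₂ (P.schedN b) j := by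
    rw [S.svS_N_eq F P b, ← S.sideS₂_N_eq P b]; push_cast; ring
  have h2S : (0 : ℝ) < 2 ^ P.SdN := by positivity
  have hreal : ((2 * S.Lb (S.svS F (P.schedN b)) P.SdN j : ℕ) : ℝ) ≤ (P.K : ℝ) * P.N * P.LV / (2 ^ P.SdN * P.A j) := by
    rw [hPN]
    push_cast
    rw [hsv] at h1
    -- `2·Lb ≤ 4·N·side/2^Sd ≤ 2·N·LV/(2^Sd·A) ≤ K·N·LV/(2^Sd·A)`
    have h3a : 2 * (S.Lb (S.svS F (P.schedN b)) P.SdN j : ℝ) ≤ 2 * (2 * ((F.N : ℝ) * (S.sideS₂ (P.schedN b) j : ℝ)) / 2 ^ P.SdN) := by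
      linarith
    have h5 : 2 * (2 * ((F.N : ℝ) * (S.sideS₂ (P.schedN b) j : ℝ)) / 2 ^ P.SdN) ≤ 2 * (2 * ((F.N : ℝ) * (P.LV / (2 * P.A j))) / 2 ^ P.SdN) := by
      gcongr
    have e : 2 * (2 * ((F.N : ℝ) * (P.LV / (2 * P.A j))) / 2 ^ P.SdN) = 2 * F.N * P.LV / (2 ^ P.SdN * P.A j) := by
      field_simp
    have h3 : 2 * (S.Lb (S.svS F (P.schedN b)) P.SdN j : ℝ) ≤ 2 * F.N * P.LV / (2 ^ P.SdN * P.A j) := by linarith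
    refine h3.trans ?_
    rw [div_le_div_iff_of_pos_right (by positivity)]
    nlinarith [mul_nonneg (mul_nonneg (sub_nonneg.mpr hK') hN.le) hL]
  have : 2 * S.Lb (S.svS F (P.schedN b)) P.SdN j ≤ ⌊(P.K : ℝ) * P.N * P.LV / (2 ^ P.SdN * P.A j)⌋₊ := Nat.le_floor hreal
  unfold PadicG3ParN.DN
  omega

/-- **END sizing of the saturated frame on `schedN b`** (`K ≥ 2`, `b ≥ 1`, record `N` = frame `N`): the four END hypotheses of
`recordSupplyAtSatR_of_pack` with `(X', S₀, D₀, D) = (XfinOS (schedN b), S0NV, D0N, DN)`. [cite: Nesterenko2003, §5; shape only] -/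
theorem endSizingSatN (hPN : P.N = F.N) (hK : 2 ≤ P.K) (hb : 1 ≤ b) :
    2 * ((S.n + 1) * S.XfinOS (P.schedN b)) ≤ S.NS (P.schedN b) (P.schedN b).Sd S.n ∧
    (S.n + 1) * P.S0NV < S.TordS (P.schedN b) (P.schedN b).Sd S.n ∧ (P.schedN b).L₀ ≤ P.D0N ∧
    ∀ j, 2 * S.Lb (S.svS F (P.schedN b)) (P.schedN b).Sd j ≤ P.DN j := by
  refine ⟨S.two_mul_XfinOS_le (P.schedN b), ?_, ?_, fun j => S.two_mul_Lb_svS_Sd_le F P b hPN hK hb j⟩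
  · refine S.succ_mul_lt_TordS_last (P.schedN b) ?_ ?_
    · have hK1 := P.K1V
      have hn := P.hn
      have : 2 ≤ 2 * S.n * (S.n + 1) * (P.LgV / 2 ^ (S.n + 22) + 1) := by
        have h1 : 1 ≤ P.LgV / 2 ^ (S.n + 22) + 1 := Nat.le_add_left 1 _
        calc 2 = 2 * 1 * 1 * 1 := by ring
          _ ≤ 2 * S.n * (S.n + 1) * (P.LgV / 2 ^ (S.n + 22) + 1) := by (gcongr; omega)
      generalize 2 * S.n * (S.n + 1) * (P.LgV / 2 ^ (S.n + 22) + 1) = e at this hK1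
      omega
    · show (S.n + 2) * P.S0NV ≤ P.MordN P.SdN S.n
      refine le_trans ?_ (P.MV_div_le_MordN P.SdN S.n)
      unfold PadicG3Par.S0NV
      rw [show P.MV / (S.n + 2) ^ 4 = P.MV / (S.n + 2) ^ 3 / (S.n + 2) by rw [Nat.div_div_eq_div_mul, ← pow_succ], mul_comm]
      exact Nat.div_mul_le_self _ _
  · show P.L0N ≤ P.D0N
    unfold PadicG3ParN.D0N; omega

end G3Setup

end Summit.ABC.StewartYu

end
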